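import Mathlib
import HarnessLib
import Literature.MathematicalPhysics.StatisticalMechanics.WeightIntegrationABKM
import Literature.MathematicalPhysics.StatisticalMechanics.WeightIntegrationStepABKM

/-!
# Theorem 7.1 (w7) and the subcriticality margin for a step covariance DOMINATED by
# `(1+ρ)𝒞_{k+1}` in Fourier multipliers ([ABKM19] Lemma 7.7 for `q ∈ B_κ`, (7.71)–(7.76))

[ABKM19] need the integration property of the `q = 0` weights "not only for `μ_{k+1}^{(0)}` but
also for `q` in a small neighbourhood `B_κ(0)`" (proof of Lemma 7.7): the covariances are
comparable, `𝒞^{(q)}_{k+1} ≤ (1+ρ)𝒞^{(0)}_{k+1}` mode by mode ((7.75)), and then the determinant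
and trace estimates of the `q = 0` case go through with `(1+ρ)` in place of `1` ((7.76):
`(1+ρ)𝒞^{1/2}A_k^X𝒞^{1/2} ≤ (1+ρ)²/(1+θ̄) < 1 − ρ/2`).  This file proves exactly that layer,
generically in the multipliers: for the multiplier tower of `WeightTowerIntegrationMultipliers`
(`W.cov k = mulMat((1+θ̄)c_{k+1})`, dominator `d_k = (λm_k⁻¹ + (1+θ_k)t_k)⁻¹`,
`t_k = c_{k+1} + t_{k+1}`, `θ̄ ≤ θ_k`) and ANY even non-negative step multiplier `c'` with
`c' ≤ (1+ρ)c_{k+1}`, `0 ≤ ρ < θ̄`: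

* `mul_domMul_le_of_le` — the scalar margin `c'd_k ≤ (1+ρ)(1+θ_k)⁻¹` ((7.71));
* `posSemidef_cov_sub_mulMat_of_le` — `mulMat c' ⪯ W.cov k`;
* **`posDef_one_sub_smul_form_of_le`** — `1 − √C'((1+η)A_k^X)√C' ≻ 0` whenever
  `(1+η)(1+ρ) < 1+θ̄` (the section-domination margin of Lemma 8.4 for `μ^{(q)}_{k+1}`);
* **`WeightData.integral_weight_add_le_of_multipliers_le`** — (w7) against `N(0, mulMat c')`:
  `∫ w_k^X(φ+ψ) N(0, mulMat c')(dψ) ≤ (1−θ')^{−tr(√C' A_k^X √C')/(2θ')} w_{k:k+1}^X(φ)`,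
  `θ' = (1+ρ)/(1+θ̄)`;
* `trace_sqrt_mulMat_form_le_of_le` — `tr(√C' A √C') ≤ (1+ρ) tr(√C A √C)` for `A ⪰ 0`,
  `C = mulMat c_{k+1}`, `C' = mulMat c'`;
* `weightIntConstRho`, `one_le_weightIntConstRho` — the constant
  `A_𝒫(ρ)/2 = (1−θ')^{−(1+ρ)c₁/(2θ')}`;
* **`integral_weight_abkm_le_of_multipliers_le`** — Theorem 7.1 (w7) for the torus weight data
  `abkmWeightData` against `N(0, circulant 𝒞q)` for an even kernel `𝒞q` whose multipliers satisfy
  `0 ≤ Re 𝒞̂q(κ) ≤ (1+ρ)·cExt N 𝒞̂ (k+1) κ`: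
  `∫ w_k^X(φ+ψ) N(0, circulant 𝒞q)(dψ) ≤ weightIntConstRho^{|X|_k} w_{k:k+1}^X(φ)`, the trace bound
  being `WeightTraceBoundABKM.trace_form_abkm_le` transported by the previous item.

Everything is proved; no named fact.  Not here: the comparison (7.75) itself for the finite-range
decomposition of `∇*(1+q)∇` (from the `A`-derivative and lower shell bounds of `GradientFRD.TorusFRD`).

## References
* S. Adams, S. Buchholz, R. Kotecký, S. Müller, arXiv:1910.13564, Lemma 7.7 and its proof
  ((7.71)–(7.78)), Theorem 7.1 (w7) [AdamsBuchholzKoteckyMuller2019].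
-/

noncomputable section

namespace Literature.MathematicalPhysics.StatisticalMechanics.GradientRG

open Finset Matrix Real MeasureTheory ProbabilityTheory WithLp
open scoped MatrixOrder
open Literature.MathematicalPhysics.StatisticalMechanics.GradientFRD
  (iterDiff mulMat fourierCoeff cExt cExt_of_mem circulant_eq_mulMat mulMat_smul posSemidef_mulMat
    posSemidef_mulMat_sub posSemidef_smul_one_sub_sqrt_mul_mul_sqrt_mulMat
    posDef_one_sub_sqrt_mul_mul_sqrt_mulMat)
open Literature.MathematicalPhysics.StatisticalMechanics.TorusPolymer (IsPolymer numBlocks)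

variable {d M : ℕ} [NeZero M]

/-! ## The scalar margin and the covariance comparison -/

/-- **The scalar margin for a dominated step multiplier** ([ABKM19] (7.71), (7.76)): with
`d = (λm⁻¹ + (1+θ)t)⁻¹`, `t = c + t'`, `c, t', λ, m ≥ 0`, `1 + θ > 0`, `ρ ≥ 0` and
`0 ≤ c' ≤ (1+ρ)c`: `c' · d ≤ (1+ρ)(1+θ)⁻¹`. [cite: AdamsBuchholzKoteckyMuller2019, Lemma 7.7 (7.76)] -/
theorem mul_domScalar_le_of_le {lam θ m c c' t' ρ : ℝ} (hlam : 0 ≤ lam) (hm : 0 ≤ m)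
    (hθ : 0 < 1 + θ) (hc : 0 ≤ c) (ht' : 0 ≤ t') (hρ : 0 ≤ ρ) (hc'le : c' ≤ (1 + ρ) * c) :
    c' * domScalar lam θ m (c + t') ≤ (1 + ρ) * (1 + θ)⁻¹ := by
  have hd0 : 0 ≤ domScalar lam θ m (c + t') := domScalar_nonneg hlam hθ.le hm (by linarith)
  calc c' * domScalar lam θ m (c + t') ≤ (1 + ρ) * c * domScalar lam θ m (c + t') :=
        mul_le_mul_of_nonneg_right hc'le hd0
    _ = (1 + ρ) * (c * domScalar lam θ m (c + t')) := by ring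
    _ ≤ (1 + ρ) * (1 + θ)⁻¹ :=
        mul_le_mul_of_nonneg_left (cov_mul_domScalar_le hlam hm hθ hc ht') (by linarith)

omit [NeZero M] in
/-- `c' d_k ≤ (1+ρ)(1+θ_k)⁻¹` on every mode, for the dominating multipliers `d_k = domMul λ θ m t k`
with `t_k = c_{k+1} + t_{k+1}` and a step multiplier `c' ≤ (1+ρ)c_{k+1}`.
[cite: AdamsBuchholzKoteckyMuller2019, Lemma 7.7 (7.76)] -/
theorem mul_domMul_le_of_le {lam ρ : ℝ} {θ : ℕ → ℝ} {m c t : ℕ → (Fin d → ZMod M) → ℝ} {k : ℕ}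
    (hlam : 0 ≤ lam) (hθk : 0 < 1 + θ k) (hm_nonneg : ∀ κ, 0 ≤ m k κ)
    (hc_nonneg : ∀ κ, 0 ≤ c (k + 1) κ) (ht : ∀ κ, t k κ = c (k + 1) κ + t (k + 1) κ)
    (ht_nonneg : ∀ κ, 0 ≤ t (k + 1) κ) (hρ : 0 ≤ ρ) {c' : (Fin d → ZMod M) → ℝ}
    (hc'le : ∀ κ, c' κ ≤ (1 + ρ) * c (k + 1) κ) (κ : Fin d → ZMod M) :
    c' κ * domMul lam θ m t k κ ≤ (1 + ρ) * (1 + θ k)⁻¹ := by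
  rw [domMul, ht κ]
  exact mul_domScalar_le_of_le hlam (hm_nonneg κ) hθk (hc_nonneg κ) (ht_nonneg κ) hρ (hc'le κ)

/-- **`mulMat c' ⪯ W.cov k = mulMat((1+θ̄)c_{k+1})`** for `c' ≤ (1+ρ)c_{k+1}`, `ρ ≤ θ̄`, `c_{k+1} ≥ 0`
([ABKM19] (7.75): the renormalised covariance is still dominated by the weights' step covariance).
[cite: AdamsBuchholzKoteckyMuller2019, Lemma 7.7 (7.75)] -/
theorem posSemidef_cov_sub_mulMat_of_le (W : WeightData (Fin d → ZMod M)) {θbar ρ : ℝ}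
    {c : ℕ → (Fin d → ZMod M) → ℝ} {k : ℕ}
    (hcov : W.cov k = mulMat fun κ => (1 + θbar) * c (k + 1) κ) (hρ : ρ ≤ θbar)
    (hc_nonneg : ∀ κ, 0 ≤ c (k + 1) κ) {c' : (Fin d → ZMod M) → ℝ}
    (hc'le : ∀ κ, c' κ ≤ (1 + ρ) * c (k + 1) κ) :
    (W.cov k - mulMat c').PosSemidef := by
  rw [hcov]
  exact posSemidef_mulMat_sub fun κ => by nlinarith [hc'le κ, hc_nonneg κ]

/-! ## The subcriticality margin ((7.76)) -/

/-- **`(1+η)A_k^X` is subcritical for the dominated step covariance `mulMat c'`** when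
`(1+η)(1+ρ) < 1 + θ̄` (`η, ρ ≥ 0`): the margin `c'd_k ≤ (1+ρ)(1+θ_k)⁻¹ ≤ (1+ρ)(1+θ̄)⁻¹` of the
multiplier tower. [cite: AdamsBuchholzKoteckyMuller2019, Lemma 7.7 (7.76)] -/
theorem posDef_one_sub_smul_form_of_le (W : WeightData (Fin d → ZMod M)) {lam θbar η ρ : ℝ}
    {θ : ℕ → ℝ} {m c t : ℕ → (Fin d → ZMod M) → ℝ}
    (hD : W.Dominated fun k => mulMat (domMul lam θ m t k)) {k : ℕ}
    (hθbar : 0 < θbar) (hθ : θbar ≤ θ k) (hlam : 0 ≤ lam) (hη0 : 0 ≤ η) (hρ : 0 ≤ ρ)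
    (hηρ : (1 + η) * (1 + ρ) < 1 + θbar)
    (hm_even : ∀ k κ, m k (-κ) = m k κ) (hm_nonneg : ∀ κ, 0 ≤ m k κ)
    (hc_nonneg : ∀ κ, 0 ≤ c (k + 1) κ)
    (ht_even : ∀ k κ, t k (-κ) = t k κ) (ht : ∀ κ, t k κ = c (k + 1) κ + t (k + 1) κ)
    (ht_nonneg : ∀ κ, 0 ≤ t (k + 1) κ) {c' : (Fin d → ZMod M) → ℝ}
    (hc'_even : ∀ κ, c' (-κ) = c' κ) (hc'_nonneg : ∀ κ, 0 ≤ c' κ)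
    (hc'le : ∀ κ, c' κ ≤ (1 + ρ) * c (k + 1) κ) (X : Finset (Fin d → ZMod M)) :
    ((1 : Matrix _ _ ℝ) - CFC.sqrt (mulMat c') * ((1 + η) • W.form k X) *
      CFC.sqrt (mulMat c')).PosDef := by
  have hθk : 0 < 1 + θ k := by linarith
  -- the dominator `(1+η) • mulMat d_k = mulMat ((1+η) d_k)` is subcritical for `mulMat c'`
  have hsub : ∀ κ, c' κ * ((1 + η) * domMul lam θ m t k κ) < 1 := by
    intro κ
    have h1 : c' κ * domMul lam θ m t k κ ≤ (1 + ρ) * (1 + θ k)⁻¹ :=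
      mul_domMul_le_of_le hlam hθk hm_nonneg hc_nonneg ht ht_nonneg hρ hc'le κ
    have h2 : (1 + η) * ((1 + ρ) * (1 + θ k)⁻¹) < 1 := by
      rw [← mul_assoc, ← div_eq_mul_inv, div_lt_one hθk]; linarith
    have h0 : 0 ≤ c' κ * domMul lam θ m t k κ :=
      mul_nonneg (hc'_nonneg κ) (domScalar_nonneg hlam hθk.le (hm_nonneg κ)
        (by rw [ht κ]; linarith [hc_nonneg κ, ht_nonneg κ]))
    nlinarith
  have hB := posDef_one_sub_sqrt_mul_mul_sqrt_mulMat (a := fun κ => (1 + η) * domMul lam θ m t k κ)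
    (fun κ => by simp only [domMul_neg hm_even ht_even]) hc'_even hc'_nonneg hsub
  rw [mulMat_smul] at hB
  have h12 : ((1 + η) • mulMat (domMul lam θ m t k) - (1 + η) • W.form k X).PosSemidef := by
    rw [← smul_sub]
    exact (WeightData.form_le hD k X).smul (by linarith : (0 : ℝ) ≤ 1 + η)
  exact posDef_one_sub_sqrt_mul_sqrt_anti h12 hB

/-! ## (w7) against the dominated step covariance, trace in the exponent -/

namespace WeightData

/-- **Theorem 7.1 (w7) against a DOMINATED step covariance, for the multiplier tower**: under the
hypotheses of `integral_weight_add_le_of_multipliers` and for an even non-negative step multiplier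
`c' ≤ (1+ρ)c_{k+1}` with `0 ≤ ρ < θ̄`, with `θ' = (1+ρ)/(1+θ̄)`, for every set `X` and field `φ`:
`∫ w_k^X(φ + ψ) N(0, mulMat c')(dψ) ≤ (1−θ')^{−tr(√C' A_k^X √C')/(2θ')} · w_{k:k+1}^X(φ)`,
`C' = mulMat c'`. [cite: AdamsBuchholzKoteckyMuller2019, Lemma 7.7 (ii)] -/
theorem integral_weight_add_le_of_multipliers_le (W : WeightData (Fin d → ZMod M)) {lam θbar ρ : ℝ}
    {θ : ℕ → ℝ} {m c t : ℕ → (Fin d → ZMod M) → ℝ}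
    (hD : W.Dominated fun k => mulMat (domMul lam θ m t k)) {k : ℕ}
    (hcov : W.cov k = mulMat fun κ => (1 + θbar) * c (k + 1) κ)
    (hθbar : 0 < θbar) (hθ : θbar ≤ θ k) (hlam : 0 ≤ lam) (hρ0 : 0 ≤ ρ) (hρ : ρ < θbar)
    (hm_even : ∀ k κ, m k (-κ) = m k κ) (hm_nonneg : ∀ κ, 0 ≤ m k κ)
    (hc_nonneg : ∀ κ, 0 ≤ c (k + 1) κ)
    (ht_even : ∀ k κ, t k (-κ) = t k κ) (ht : ∀ κ, t k κ = c (k + 1) κ + t (k + 1) κ)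
    (ht_nonneg : ∀ κ, 0 ≤ t (k + 1) κ) {c' : (Fin d → ZMod M) → ℝ}
    (hc'_even : ∀ κ, c' (-κ) = c' κ) (hc'_nonneg : ∀ κ, 0 ≤ c' κ)
    (hc'le : ∀ κ, c' κ ≤ (1 + ρ) * c (k + 1) κ)
    (X : Finset (Fin d → ZMod M)) (φ : (Fin d → ZMod M) → ℝ) :
    ∫ ψ, W.weight k X (φ + ofLp ψ) ∂(multivariateGaussian 0 (mulMat c')) ≤
      (1 - (1 + ρ) / (1 + θbar)) ^ (-((CFC.sqrt (mulMat c') * W.form k X *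
          CFC.sqrt (mulMat c')).trace / (2 * ((1 + ρ) / (1 + θbar))))) * W.midWeight k X φ := by
  have hθk : 0 < 1 + θ k := by linarith
  have hθ'0 : 0 < (1 + ρ) / (1 + θbar) := by positivity
  have hθ'1 : (1 + ρ) / (1 + θbar) < 1 := by rw [div_lt_one (by linarith)]; linarith
  refine integral_weight_add_le_of_cov_le hD (posSemidef_mulMat hc'_nonneg)
    (posSemidef_cov_sub_mulMat_of_le W hcov hρ.le hc_nonneg hc'le) hθ'0 hθ'1 ?_ X φ
  -- the margin `c' d_k ≤ (1+ρ)(1+θ_k)⁻¹ ≤ (1+ρ)(1+θ̄)⁻¹` on every mode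
  refine posSemidef_smul_one_sub_sqrt_mul_mul_sqrt_mulMat (domMul_neg hm_even ht_even k) hc'_even
    hc'_nonneg fun κ => ?_
  refine (mul_domMul_le_of_le hlam hθk hm_nonneg hc_nonneg ht ht_nonneg hρ0 hc'le κ).trans ?_
  rw [div_eq_mul_inv]
  exact mul_le_mul_of_nonneg_left (inv_anti₀ (by linarith) (by linarith)) (by linarith)

end WeightData

/-! ## Transport of the trace bound and the constant `A_𝒫(ρ)` -/

/-- **`tr(√C' A √C') ≤ (1+ρ) · tr(√C A √C)`** for `A ⪰ 0`, `C = mulMat c`, `C' = mulMat c'` with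
`0 ≤ c' ≤ (1+ρ)c`, `c ≥ 0` ("for symmetric operators `A ≥ B` implies `Tr A ≥ Tr B`", (7.72), after
`tr(√C' A √C') = tr(A C')`). [cite: AdamsBuchholzKoteckyMuller2019, Lemma 7.7 (i) (7.72)] -/
theorem trace_sqrt_mulMat_form_le_of_le {A : Matrix (Fin d → ZMod M) (Fin d → ZMod M) ℝ}
    (hA : A.PosSemidef) {ρ : ℝ} {c c' : (Fin d → ZMod M) → ℝ} (hc_nonneg : ∀ κ, 0 ≤ c κ)
    (hc'_nonneg : ∀ κ, 0 ≤ c' κ) (hc'le : ∀ κ, c' κ ≤ (1 + ρ) * c κ) :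
    (CFC.sqrt (mulMat c') * A * CFC.sqrt (mulMat c')).trace ≤
      (1 + ρ) * (CFC.sqrt (mulMat c) * A * CFC.sqrt (mulMat c)).trace := by
  rw [trace_sqrt_mul_sqrt_eq_trace_mul (posSemidef_mulMat hc'_nonneg),
    trace_sqrt_mul_sqrt_eq_trace_mul (posSemidef_mulMat hc_nonneg),
    Matrix.trace_mul_comm A (mulMat c'), Matrix.trace_mul_comm A (mulMat c)]
  have hle : ((1 + ρ) • mulMat c - mulMat c').PosSemidef := by
    rw [← mulMat_smul]
    exact posSemidef_mulMat_sub hc'le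
  calc (mulMat c' * A).trace ≤ (((1 + ρ) • mulMat c) * A).trace :=
        trace_mul_le_trace_mul_of_posSemidef hle hA
    _ = (1 + ρ) * (mulMat c * A).trace := by rw [Matrix.smul_mul, Matrix.trace_smul, smul_eq_mul]

/-- **The constant `A_𝒫(ρ)/2 = (1−θ')^{−(1+ρ)c₁/(2θ')}`**, `θ' = (1+ρ)/(1+θ̄)`, of Theorem 7.1 (w7)
for `q ∈ B_κ` (at `ρ = 0` it is `weightIntConst θ̄ c₁`). [cite: AdamsBuchholzKoteckyMuller2019, Theorem 7.1 (w7)] -/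
def weightIntConstRho (θbar ρ c₁ : ℝ) : ℝ :=
  (1 - (1 + ρ) / (1 + θbar)) ^ (-((1 + ρ) * c₁ / (2 * ((1 + ρ) / (1 + θbar)))))

/-- `weightIntConstRho θ̄ 0 c₁ = weightIntConst θ̄ c₁`. [cite: AdamsBuchholzKoteckyMuller2019, Theorem 7.1 (w7)] -/
theorem weightIntConstRho_zero (θbar c₁ : ℝ) : weightIntConstRho θbar 0 c₁ = weightIntConst θbar c₁ := by
  unfold weightIntConstRho weightIntConst
  simp only [add_zero, one_mul, one_div]

/-- `A_𝒫(ρ)/2 ≥ 1` for `0 ≤ ρ < θ̄`, `c₁ ≥ 0`. [cite: AdamsBuchholzKoteckyMuller2019, Theorem 7.1 (w7)] -/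
theorem one_le_weightIntConstRho {θbar ρ c₁ : ℝ} (hθbar : 0 < θbar) (hρ0 : 0 ≤ ρ) (hρ : ρ < θbar)
    (hc₁ : 0 ≤ c₁) : 1 ≤ weightIntConstRho θbar ρ c₁ := by
  unfold weightIntConstRho
  have hθ'1 : (1 + ρ) / (1 + θbar) < 1 := by rw [div_lt_one (by linarith)]; linarith
  have hθ'0 : 0 < (1 + ρ) / (1 + θbar) := by positivity
  have h1 : 0 < 1 - (1 + ρ) / (1 + θbar) := by linarith
  have h2 : 1 - (1 + ρ) / (1 + θbar) ≤ 1 := by linarith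
  exact Real.one_le_rpow_of_pos_of_le_one_of_nonpos h1 h2
    (neg_nonpos.2 (div_nonneg (mul_nonneg (by linarith) hc₁) (by positivity)))

/-! ## Theorem 7.1 (w7) for the torus weight data against a dominated step kernel -/

/-- **[ABKM19] Theorem 7.1 (w7) for the weight data on the torus and `q ∈ B_κ`**: hypotheses on
the weight tower as in `integral_weight_abkm_le` (odd `L ≥ 2^{d+3} + 16R`, `1 ≤ M_ord ≤ R`,
`d ≥ 2`, domination by the multiplier sequence with `0 < θ̄ ≤ θ_k`, `λ > 0`, even coefficients with
non-negative multipliers vanishing at the zero mode, the weight kernel `𝒞_{k+1}` even with the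
real-space bounds (iv) up to order `n ≥ 2M_ord`), and a STEP kernel `𝒞q`, even, whose Fourier
multipliers satisfy `0 ≤ Re 𝒞̂q(κ) ≤ (1+ρ) · ĉ_{k+1}(κ)` with `0 ≤ ρ < θ̄`; then for a `k`-polymer
`X` and every field `φ`:
`∫ w_k^X(φ + ψ) N(0, circulant 𝒞q)(dψ) ≤ weightIntConstRho^{|X|_k} · w_{k:k+1}^X(φ)`.
[cite: AdamsBuchholzKoteckyMuller2019, Lemma 7.7 (ii)] -/
theorem integral_weight_abkm_le_of_multipliers_le {L N Mord R : ℕ} (hd : 2 ≤ d) (hMord : 1 ≤ Mord)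
    (hMR : Mord ≤ R) (hLodd : Odd L) (hL : 2 ^ (d + 3) + 16 * R ≤ L) {θbar : ℝ} (hθbar : 0 < θbar)
    {δ' : ℕ → ℝ} {𝒞 : ℕ → (Fin d → ZMod M) → ℝ} {lam : ℝ} (hlam : 0 < lam) {θ : ℕ → ℝ}
    (hθlo : ∀ k, θbar ≤ θ k)
    (hnn : ∀ (j : ℕ) (κ : Fin d → ZMod M), 0 ≤ cExt N (fun j => fourierCoeff (𝒞 j) κ) j)
    (hf_zero : ∀ j : ℕ, cExt N (fun j => fourierCoeff (𝒞 j) (0 : Fin d → ZMod M)) j = 0)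
    (hf_even : ∀ (κ : Fin d → ZMod M) (j : ℕ), cExt N (fun j => fourierCoeff (𝒞 j) (-κ)) j =
      cExt N (fun j => fourierCoeff (𝒞 j) κ) j)
    (hD : (abkmWeightData L N Mord R θbar δ' 𝒞).Dominated fun k =>
      mulMat (domMul lam θ (fun k => derivMul (L : ℝ) k (diffIndex d Mord))
        (tailMul N fun κ j => fourierCoeff (𝒞 j) κ) k))
    {k : ℕ} (hk : k + 1 ≤ N + 1) (heven : ∀ x, 𝒞 (k + 1) (-x) = 𝒞 (k + 1) x)
    {n : ℕ} (hn : 2 * Mord ≤ n) {Cα : (Fin d → ℕ) → ℕ → ℝ}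
    (hreg : ∀ θ' : Fin d → ℕ, ∑ i, θ' i ≤ n → ∀ x,
      |iterDiff θ' (𝒞 (k + 1)) x| ≤ Cα θ' 0 / (L : ℝ) ^ ((k + 1 - 1) * (d - 2 + ∑ i, θ' i)))
    {ρ : ℝ} (hρ0 : 0 ≤ ρ) (hρ : ρ < θbar) {𝒞q : (Fin d → ZMod M) → ℝ}
    (hqeven : ∀ x, 𝒞q (-x) = 𝒞q x) (hq_nonneg : ∀ κ, 0 ≤ (fourierCoeff 𝒞q κ).re)
    (hq_le : ∀ κ, (fourierCoeff 𝒞q κ).re ≤ (1 + ρ) * cExt N (fun j => fourierCoeff (𝒞 j) κ) (k + 1))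
    {X : Finset (Fin d → ZMod M)} (hX : IsPolymer (L ^ k) X) (φ : (Fin d → ZMod M) → ℝ) :
    ∫ ψ, (abkmWeightData L N Mord R θbar δ' 𝒞).weight k X (φ + ofLp ψ)
        ∂(multivariateGaussian 0 (Matrix.circulant 𝒞q)) ≤
      weightIntConstRho θbar ρ (traceConst d Mord R lam (derivSum d n Cα)) ^ numBlocks (L ^ k) X *
        (abkmWeightData L N Mord R θbar δ' 𝒞).midWeight k X φ := by
  set W := abkmWeightData L N Mord R θbar δ' 𝒞 with hW
  set c' : (Fin d → ZMod M) → ℝ := fun κ => (fourierCoeff 𝒞q κ).re with hc'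
  have hθw : ∀ k, 0 ≤ 1 + θ k := fun k => by linarith [hθlo k]
  have hCq : Matrix.circulant 𝒞q = mulMat c' := circulant_eq_mulMat hqeven
  have hc'_even : ∀ κ, c' (-κ) = c' κ := fun κ => by
    simp only [hc', GradientFRD.fourierCoeff_neg_of_even hqeven]
  -- (w7) against the dominated covariance, trace in the exponent
  have hcov : W.cov k = mulMat fun κ => (1 + θbar) * cExt N (fun j => fourierCoeff (𝒞 j) κ) (k + 1) :=
    rfl
  have hF := WeightData.integral_weight_add_le_of_multipliers_le W (c := fun j κ =>
      cExt N (fun j => fourierCoeff (𝒞 j) κ) j) hD hcov hθbar (hθlo k) hlam.le hρ0 hρ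
    (fun k κ => derivMul_neg _ k _ κ) (fun κ => derivMul_nonneg (Nat.cast_nonneg L) k _ κ)
    (fun κ => hnn (k + 1) κ)
    (fun k κ => tailMul_neg_of_cExt hf_even k κ) (fun κ => tailMul_succ N _ k κ)
    (fun κ => tailMul_nonneg (fun κ j => hnn j κ) (k + 1) κ) hc'_even hq_nonneg hq_le X φ
  rw [← hCq] at hF
  refine hF.trans (mul_le_mul_of_nonneg_right ?_ (WeightData.midWeight_pos _ _ _).le)
  -- the trace bound for the weight kernel, transported to the dominated one
  have htr := trace_form_abkm_le hd hMord hMR hLodd hL hlam hθw hnn hf_zero hD hk heven hn hreg hX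
  have hCeq := circulant_eq_mulMat_cExt hk heven (N := N)
  have htr' : (CFC.sqrt (Matrix.circulant 𝒞q) * W.form k X * CFC.sqrt (Matrix.circulant 𝒞q)).trace ≤
      (1 + ρ) * (traceConst d Mord R lam (derivSum d n Cα) * numBlocks (L ^ k) X) := by
    rw [hCq]
    rw [hCeq] at htr
    exact (trace_sqrt_mulMat_form_le_of_le (WeightData.form_posSemidef hD k X)
      (fun κ => hnn (k + 1) κ) hq_nonneg hq_le).trans (mul_le_mul_of_nonneg_left htr (by linarith))
  set θw : ℝ := (1 + ρ) / (1 + θbar) with hθwdef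
  have hθw0 : 0 < θw := by positivity
  have hθw1 : θw < 1 := by rw [hθwdef, div_lt_one (by linarith)]; linarith
  have h1θ : 0 < 1 - θw := by linarith
  set c₁ := traceConst d Mord R lam (derivSum d n Cα) with hc₁
  calc (1 - θw) ^ (-((CFC.sqrt (Matrix.circulant 𝒞q) * W.form k X *
          CFC.sqrt (Matrix.circulant 𝒞q)).trace / (2 * θw)))
      ≤ (1 - θw) ^ (-((1 + ρ) * (c₁ * numBlocks (L ^ k) X) / (2 * θw))) := by
        refine Real.rpow_le_rpow_of_exponent_ge h1θ (by linarith) (neg_le_neg ?_)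
        exact div_le_div_of_nonneg_right htr' (by linarith)
    _ = weightIntConstRho θbar ρ c₁ ^ numBlocks (L ^ k) X := by
        rw [weightIntConstRho, ← hθwdef, ← Real.rpow_natCast, ← Real.rpow_mul h1θ.le]
        congr 1; ring

end Literature.MathematicalPhysics.StatisticalMechanics.GradientRG

end
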